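import Summits.HodgeConjecture.HodgeConjecture.Theorems.R90S6OrbitalIndicatorShellCount     -- ★ (J1) p863375 `orbitalIntegral_indicator_quotientMeasure_eq_mul_ncard_shell` (generic: `O_γ(1_S) = ν(K)·#{q : q.out⁻¹ γ q.out ∈ S}`)
import Summits.HodgeConjecture.HodgeConjecture.Theorems.R90S6EllipticOrbitalDisplacement    -- ★ (J2) p863402 `ncard_quotient_shell_eq_ncard_selfDual_displaced`, `dist_latticeGraphPerm_latticeGraphPerm_mul_eq` (+ ★ W7-i ∕ W8-d dictionaries)
import Summits.HodgeConjecture.HodgeConjecture.Theorems.R90S6TreeDisplacementSphereCount    -- ★ W8-f p10 `ncard_displaced_inter_type_eq_of_odd ∕ _of_even` (closed forms); brings ★ `TreeDisplacement.finite_setOf_dist_self_apply_eq'`, `dist_self_apply_eq_two_mul_dist`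
import Literature.NumberTheory.Automorphic.HeckeEigencharacterPackage                        -- ★ `mem_doubleCoset_iff_mk_mem_orbit` (double coset `K s K` ↔ `K`-orbit of `sK` in `G ⧸ K`)
import Literature.NumberTheory.Automorphic.HyperspecialUnitaryCompactOpen                     -- ★ `isOpen_unitaryInt` (`K₀` is open in `U(σ, H)`)
import HarnessLib

/-!
# R90 · S6 «Ch. 14.1–14.5 stable trace formula» — CARD A1 (rows E1.3.5.2.3 ∕ E1.3.5.2.6): THE ELLIPTIC ORBITAL INTEGRAL OF A HECKE BASIS ELEMENT
# IS A DISPLACEMENT COUNT ON THE BRUHAT–TITS TREE — THE ASSEMBLY (`Theorems/R90S6EllipticOrbitalDisplacementCount.lean`)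

DAG r8 rows E1.3.5.2.3 «DISPLACEMENT GEOMETRY on the biregular tree» ∕ E1.3.5.2.6 «THE [BR₁] IDENTITY PROPER (elliptic half)» (dealer R90-C14-plan (g2), CARD A1
2026-09-05T00:30:40Z: «today the three bricks are ★ but the sentence “orbital integral = displacement count” is not one citable decl»).  `K` a discretely valued
field with the cell's unramified datum `hd : UnramifiedLocalConjDatum σ ϖ`, `U = U(σ, J₀)(K)` the quasi-split unitary group in three variables (topological group from
`Valued K`), `K₀ = unitaryInt σ J₀` its hyperspecial subgroup (open, ★ `isOpen_unitaryInt`), `t = hd.torusGen = diag(ϖ, 1, ϖ⁻¹)`, `φ_m = 1_{K₀ tᵐ K₀}` the `m`-th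
Hecke basis element as the indicator of the double coset `DoubleCoset.doubleCoset (t ^ m) K₀ K₀ = K₀ · {tᵐ} · K₀` (the currency of ★ `disjoint_doubleCoset_torusGen_pow`,
★ `isLevel_indicator_doubleCoset`), `X` the lattice tree `latticeGraph σ ϖ J₀` (★ `isTree_latticeGraph_three_of_unramified`) on which `γ ∈ U` acts by `latticeGraphIso γ`.
For `γ` with COMPACT centraliser `C = C_U(γ)` («elliptic»), `t` the Haar measure on `C` of mass one, `ν` a Haar measure on `U`, `O_γ = orbitalIntegral γ · (quotientMeasure C t ν)`:

* §1 (generic group `G`, open `K ≤ G`, `s ∈ G`) **`orbitalIntegral_indicator_doubleCoset_eq_mul_ncard_orbitShell`**: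
  `O_γ(1_{K s K}) = ν(K) · #{q ∈ G ⧸ K : (q.out⁻¹ γ q.out) K ∈ K · sK}` — ★ (J1) with its two side conditions DISCHARGED for double cosets (`isOpen_doubleCoset`,
  `conj_mem_doubleCoset_iff`) and the shell written in the ORBIT currency of ★ `heckeOperator` ∕ (J2) (`setOf_out_conj_mem_doubleCoset_eq`, by ★ `mem_doubleCoset_iff_mk_mem_orbit`).
* §2 (U(3)) the finiteness transfer **`finite_quotient_shell_of_finite_displaced`** (the injection `q ↦ q.out · 𝒪³` of ★ W7-i §1) and, from a finite non-empty fixed set on a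
  locally finite tree, **`finite_selfDual_displaced_of_finite_fixedPoints`** (★ `TreeDisplacement.finite_setOf_dist_self_apply_eq'`).
* §3 THE ASSEMBLY **`orbitalIntegral_doubleCosetShell_eq_mul_ncard_displaced`**: `O_γ(1_{K₀ tᵐ K₀}) = ν(K₀) · #{x ∈ X hyperspecial : d(x, γ·x) = 2m}` (★ (J1) ∘ §1 ∘ ★ (J2)),
  its ELLIPTIC edition **`…_of_finite_fixedPoints`** (finiteness discharged from `Fix γ` finite non-empty + local finiteness), and the «distance to the fixed subtree» reading
  **`orbitalIntegral_doubleCosetShell_eq_mul_ncard_nearest_fixed`**: `= ν(K₀) · #{x hyperspecial : d(x, Fix γ) = m}` — «`d(x, Fix γ) = m`» spelled with a NEAREST fixed vertex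
  `p` (`γp = p`, `∀ q fixed, d(x,p) ≤ d(x,q)`, `d(x,p) = m`), the binder shape of ★ W6-a `dist_map_eq_two_mul_of_nearest_fixed` (Serre I.6.4: `d(x, γx) = 2·d(x, Fix γ)`).
* §4 CLOSED FORM modulo the first shell (★ W8-f p10): for a type function `c` (`c v = 0 ↔ v` self-dual, ★ `exists_typeFun` ∕ `typeFun_ne_of_adj`) and valencies `q (c v) + 1` at the
  moved vertices, **`orbitalIntegral_doubleCosetShell_odd_eq`**: `O_γ(φ_{2n+1}) = ν(K₀)·(q₁q₀)ⁿ·#{x : d(x,γx) = 2, c x = 0}` and **`orbitalIntegral_doubleCosetShell_even_eq`**: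
  `O_γ(φ_{2n+2}) = ν(K₀)·q₁(q₀q₁)ⁿ·#{x : d(x,γx) = 2, c x = 1}` (for `U(3)_w` at an inert place `q₀ = q_v³`, `q₁ = q_v`, ★ `ncard_neighborSet_eq_typeFun`).

Cell `hodgecm-mathlib`, crux H413 (`stmt-HodgeConjecture-24833`), route of record `HCCMUnconditional`; programme R90-TF (brief `director/R90-BRIEF.v2.md` 1f40d54518340a35),
section S6 (base `R90-C14`), seat R90-C14-p01 (g2).  Lane `--kind proof --supports stmt-HodgeConjecture-24833 --as helper`; THEOREMS ONLY over ★ carriers (no definition, no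
instance, no notation, no named fact, no kit, no `sorry`); Theorems import Theorems ((J1), (J2), W8-f), never `Lines/`.
HONEST LABEL: assembly of ★ bricks, count-neutral until E1.3.5.2.6 (the [BR₁] identity proper) consumes it; proves no printed global statement, discharges no citation;
HC_CM is proved only modulo the 7 printed citations (2 remaining named inputs: hLiu418 = stmt-HodgeConjecture-24832, h413 = stmt-HodgeConjecture-24833) until rung 0 closes.

## References
* [Rogawski1990] J. D. Rogawski, *Automorphic Representations of Unitary Groups in Three Variables*, Ann. of Math. Stud. 123 (1990): §4.9 pp. 54–55
  («`Φ(γ, f) = Σ_{x ∈ G_γ\G∕K} vol(G_γ ∩ xKx⁻¹)⁻¹ f(x⁻¹γx)`», `Φ^κ(γ, φ)` for the Hecke basis).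
* [Kottwitz1986BaseChangeUnits] R. E. Kottwitz, *Base change for unit elements of Hecke algebras*, Compositio Math. 60 (1986): §1 pp. 240–242 (orbital integrals of units as fixed-point sums with stabiliser measures).
* [Serre1980Trees] J.-P. Serre, *Trees* (1980): I.6.4 Prop. 24–25 (`d(x, γx) = 2 d(x, Fix γ)`), I.2.3 Ex. 2, II.1.1.
* [BruhatTits1972] F. Bruhat, J. Tits, *Groupes réductifs sur un corps local I*, Publ. Math. IHÉS 41 (1972): §10, (4.4.3).
* [Laumon1995] G. Laumon, *Cohomology of Drinfeld Modular Varieties*, Part I (1996): Lemma (5.3.2) p. 136.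
-/

set_option autoImplicit false
-- the mandated namespace repeats the single-problem summit's segment (`HodgeConjecture.HodgeConjecture`)
set_option linter.dupNamespace false

noncomputable section

open MeasureTheory Measure Topology Set Function
open scoped ENNReal NNReal Pointwise Valued WithZero Matrix MatrixGroups
open MulAction SimpleGraph
open Literature.MeasureTheory.Group Literature.NumberTheory.Automorphic
open Literature.NumberTheory.Automorphic.HermitianLattice Literature.NumberTheory.Automorphic.UnitaryLatticeTree
open Literature.Combinatorics.SimpleGraph

namespace Summit.HodgeConjecture.HodgeConjecture.R90.S6

/-! ## §1 Generic layer: the orbital integral of `1_{K s K}` is `ν(K)` times the number of cosets in the `K`-orbit shell -/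

section Generic

variable {G : Type*} [Group G] (K : Subgroup G) (s : G)

/-- **A double coset `K s K` is invariant under conjugation by `K`**: `k g k⁻¹ ∈ K s K ↔ g ∈ K s K` for `k ∈ K` (the hypothesis `hSK` of ★ (J1)).
[cite: Rogawski1990, §4.9 p. 54] -/
theorem conj_mem_doubleCoset_iff (k : G) (hk : k ∈ K) (g : G) :
    k * g * k⁻¹ ∈ DoubleCoset.doubleCoset s (K : Set G) K ↔ g ∈ DoubleCoset.doubleCoset s (K : Set G) K := by
  constructor
  · intro h
    obtain ⟨x, hx, y, hy, hxy⟩ := DoubleCoset.mem_doubleCoset.1 h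
    refine DoubleCoset.mem_doubleCoset.2 ⟨k⁻¹ * x, K.mul_mem (K.inv_mem hk) hx, y * k, K.mul_mem hy hk, ?_⟩
    calc g = k⁻¹ * (k * g * k⁻¹) * k := by group
      _ = k⁻¹ * (x * s * y) * k := by rw [hxy]
      _ = k⁻¹ * x * s * (y * k) := by group
  · intro h
    obtain ⟨x, hx, y, hy, hxy⟩ := DoubleCoset.mem_doubleCoset.1 h
    refine DoubleCoset.mem_doubleCoset.2 ⟨k * x, K.mul_mem hk hx, y * k⁻¹, K.mul_mem hy (K.inv_mem hk), ?_⟩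
    rw [hxy]
    group

/-- **The two shell currencies agree**: `q.out⁻¹ γ q.out ∈ K s K` (★ (J1), set currency) `↔ (q.out⁻¹ γ q.out)K ∈ K · sK` (★ (J2), orbit currency of ★ `heckeOperator`), by ★
`mem_doubleCoset_iff_mk_mem_orbit`. [cite: Rogawski1990, §4.9 p. 54] -/
theorem setOf_out_conj_mem_doubleCoset_eq (γ : G) :
    {q : G ⧸ K | q.out⁻¹ * γ * q.out ∈ DoubleCoset.doubleCoset s (K : Set G) K} =
      {q : G ⧸ K | ((q.out⁻¹ * γ * q.out : G) : G ⧸ K) ∈ MulAction.orbit K (s : G ⧸ K)} := by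
  ext q
  exact mem_doubleCoset_iff_mk_mem_orbit s _

variable [TopologicalSpace G] [IsTopologicalGroup G]

/-- A double coset of an OPEN subgroup is open (`K s K = (K·{s})·K`). [cite: Rogawski1990, §4.9 p. 54] -/
theorem isOpen_doubleCoset (hK : IsOpen (K : Set G)) : IsOpen (DoubleCoset.doubleCoset s (K : Set G) K) := by
  rw [DoubleCoset.doubleCoset]
  exact hK.mul_left

variable [LocallyCompactSpace G] [SecondCountableTopology G] [T2Space G] [MeasurableSpace G] [BorelSpace G]
  (γ : G) [MeasurableSpace (G ⧸ Subgroup.centralizer ({γ} : Set G))] [BorelSpace (G ⧸ Subgroup.centralizer ({γ} : Set G))]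
  [hC : IsClosed ((Subgroup.centralizer ({γ} : Set G) : Subgroup G) : Set G)]
  (t : Measure (Subgroup.centralizer ({γ} : Set G))) [t.IsMulLeftInvariant]
  [IsFiniteMeasureOnCompacts t] [t.IsOpenPosMeasure] [t.IsInvInvariant] [SFinite t]
  (ν : Measure G) [IsHaarMeasure ν] [ν.IsMulRightInvariant]
  [CompactSpace (Subgroup.centralizer ({γ} : Set G))]

/-- **`O_γ^{ν∕t}(1_{K s K}) = ν(K) · #{q ∈ G ⧸ K : (q.out⁻¹ γ q.out) K ∈ K · sK}`** — the orbital integral of the indicator of a double coset of an open subgroup `K` at an element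
with COMPACT centraliser of `t`-mass one is `ν(K)` times the number of cosets in the shell (finitely many of them): ★ (J1) `orbitalIntegral_indicator_quotientMeasure_eq_mul_ncard_shell`
with `S = K s K` (open, `K`-conjugation invariant) and the shell in orbit currency.  Rogawski's `Φ(γ, 1_{KsK}) = Σ_{x ∈ G_γ\G∕K} vol(G_γ ∩ xKx⁻¹)⁻¹ 1_{KsK}(x⁻¹γx)`.
[cite: Rogawski1990, §4.9 pp. 54–55] [cite: Laumon1995, Lemma (5.3.2) p. 136] -/
theorem orbitalIntegral_indicator_doubleCoset_eq_mul_ncard_orbitShell (hK : IsOpen (K : Set G)) (ht : t Set.univ = 1)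
    (hfin : {q : G ⧸ K | ((q.out⁻¹ * γ * q.out : G) : G ⧸ K) ∈ MulAction.orbit K (s : G ⧸ K)}.Finite) :
    orbitalIntegral γ ((DoubleCoset.doubleCoset s (K : Set G) K).indicator (1 : G → ℝ))
        (quotientMeasure (Subgroup.centralizer ({γ} : Set G)) t hC ν) =
      (ν K).toReal * ({q : G ⧸ K | ((q.out⁻¹ * γ * q.out : G) : G ⧸ K) ∈ MulAction.orbit K (s : G ⧸ K)}.ncard : ℝ) := by
  rw [← setOf_out_conj_mem_doubleCoset_eq K s γ] at hfin ⊢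
  exact orbitalIntegral_indicator_quotientMeasure_eq_mul_ncard_shell γ K t ν (isOpen_doubleCoset K s hK)
    (conj_mem_doubleCoset_iff K s) hK ht hfin

end Generic

/-! ## §2 `U(3)`: finiteness of the shell from finiteness of the displaced hyperspecial vertices, and from a finite fixed set -/

section Unitary

variable {K : Type*} [Field K] [Valued K ℤᵐ⁰] {σ : K →+* K} {ϖ : K}

/-- **Finiteness transfer**: if only finitely many hyperspecial vertices `x` have `d(x, γx) = 2m`, then only finitely many cosets `q K₀` have `(q.out⁻¹ γ q.out)K₀ ∈ K₀ tᵐ K₀ ∕ K₀`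
(`q ↦ q.out · 𝒪³` is injective, ★ W7-i `latticeGraphIso_apartmentEnum_zero_eq_latticeGraphIso_iff`, and maps the shell into that set, ★ W8-d + ★ (J2)'s transport lemma).
[cite: BruhatTits1972, §10] [cite: Serre1980Trees, II.1.1] -/
theorem finite_quotient_shell_of_finite_displaced (hd : UnramifiedLocalConjDatum σ ϖ)
    (γ : unitaryGroupOfForm σ ((StdForm.antidiagonal 3).over K)) (m : ℕ)
    (hfin : {x : {M : Submodule 𝒪[K] (Fin 3 → K) // IsVertex σ ϖ ((StdForm.antidiagonal 3).over K) M} |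
        IsSelfDualLattice σ ϖ ((StdForm.antidiagonal 3).over K) x.1 ∧
          (latticeGraph σ ϖ ((StdForm.antidiagonal 3).over K)).dist x (latticeGraphPerm σ ϖ ((StdForm.antidiagonal 3).over K) γ x) = 2 * m}.Finite) :
    {q : unitaryGroupOfForm σ ((StdForm.antidiagonal 3).over K) ⧸ unitaryInt σ ((StdForm.antidiagonal 3).over K) |
        ((q.out⁻¹ * γ * q.out : unitaryGroupOfForm σ ((StdForm.antidiagonal 3).over K)) :
            unitaryGroupOfForm σ ((StdForm.antidiagonal 3).over K) ⧸ unitaryInt σ ((StdForm.antidiagonal 3).over K)) ∈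
          MulAction.orbit (unitaryInt σ ((StdForm.antidiagonal 3).over K))
            ((hd.torusGen ^ m : unitaryGroupOfForm σ ((StdForm.antidiagonal 3).over K)) :
              unitaryGroupOfForm σ ((StdForm.antidiagonal 3).over K) ⧸ unitaryInt σ ((StdForm.antidiagonal 3).over K))}.Finite := by
  obtain ⟨A, hA0, -⟩ := exists_apartmentEnum hd
  -- the root `x₀ = 𝒪³ = A 0`
  set x₀ : {M : Submodule 𝒪[K] (Fin 3 → K) // IsVertex σ ϖ ((StdForm.antidiagonal 3).over K) M} :=
    ⟨stdLattice K 3, 0, isSelfDualLattice_stdLattice_three_of_v hd.vϖ⟩ with hx₀def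
  have hx₀ : x₀.1 = stdLattice K 3 := rfl
  have h0 : A 0 = x₀ := Subtype.ext (coe_apartmentEnum_zero A hA0)
  -- `q ↦ q.out · x₀` is injective on `U ⧸ K₀` (★ W7-i §1)
  have hinj : Function.Injective
      (fun q : unitaryGroupOfForm σ ((StdForm.antidiagonal 3).over K) ⧸ unitaryInt σ ((StdForm.antidiagonal 3).over K) =>
        latticeGraphPerm σ ϖ ((StdForm.antidiagonal 3).over K) q.out x₀) := by
    intro q q' h
    have h' := (latticeGraphIso_apartmentEnum_zero_eq_latticeGraphIso_iff A hA0 q.out q'.out).1 (by rw [h0]; exact h)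
    rwa [QuotientGroup.out_eq', QuotientGroup.out_eq'] at h'
  refine (hfin.preimage hinj.injOn).subset fun q hq => ?_
  -- the shell condition at `q` says `q.out · x₀` is (hyperspecial and) displaced by `2m`
  refine ⟨(isVertexLattice_mapGL_iff σ ϖ ((StdForm.antidiagonal 3).over K) q.out x₀.1).2 (isSelfDualLattice_stdLattice_three_of_v hd.vϖ), ?_⟩
  rw [dist_latticeGraphPerm_latticeGraphPerm_mul_eq, ← mem_orbit_torusGen_pow_iff_dist_eq_three hd x₀ hx₀]
  exact hq

/-- **Elliptic finiteness**: if `γ` fixes a vertex, has FINITE fixed set, and the tree is locally finite (`hloc`, ★ `finite_neighborSet` at a finite residue field), then for every `m`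
only finitely many hyperspecial vertices are displaced by exactly `2m` (★ `TreeDisplacement.finite_setOf_dist_self_apply_eq'` on ★ `isTree_latticeGraph_three_of_unramified`).
[cite: Serre1980Trees, I.6.4 Prop. 24] [cite: BruhatTits1972, §10] -/
theorem finite_selfDual_displaced_of_finite_fixedPoints (hd : UnramifiedLocalConjDatum σ ϖ)
    (γ : unitaryGroupOfForm σ ((StdForm.antidiagonal 3).over K))
    (hloc : ∀ v, ((latticeGraph σ ϖ ((StdForm.antidiagonal 3).over K)).neighborSet v).Finite)
    {u : {M : Submodule 𝒪[K] (Fin 3 → K) // IsVertex σ ϖ ((StdForm.antidiagonal 3).over K) M}}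
    (hu : latticeGraphIso σ ϖ ((StdForm.antidiagonal 3).over K) γ u = u)
    (hfix : {v | latticeGraphIso σ ϖ ((StdForm.antidiagonal 3).over K) γ v = v}.Finite) (m : ℕ) :
    {x : {M : Submodule 𝒪[K] (Fin 3 → K) // IsVertex σ ϖ ((StdForm.antidiagonal 3).over K) M} |
        IsSelfDualLattice σ ϖ ((StdForm.antidiagonal 3).over K) x.1 ∧
          (latticeGraph σ ϖ ((StdForm.antidiagonal 3).over K)).dist x (latticeGraphPerm σ ϖ ((StdForm.antidiagonal 3).over K) γ x) = 2 * m}.Finite :=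
  (TreeDisplacement.finite_setOf_dist_self_apply_eq' (isTree_latticeGraph_three_of_unramified hd)
      (latticeGraphIso σ ϖ ((StdForm.antidiagonal 3).over K) γ) hu hfix hloc m).subset fun _ hx => hx.2

/-- **The displaced hyperspecial vertices are those at distance `m` from the fixed subtree**: if `γ` fixes some vertex, then `{x self-dual : d(x, γ·x) = 2m} = {x self-dual : some nearest
fixed vertex `p` of `x` has `d(x, p) = m`}` — ★ `TreeDisplacement.dist_self_apply_eq_two_mul_dist` (`d(x, γx) = 2 d(x, p)`, ★ W6-a) and the existence of a nearest fixed vertex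
(`Function.argminOn` on the non-empty fixed set). [cite: Serre1980Trees, I.6.4 Prop. 24–25] -/
theorem setOf_selfDual_displaced_eq_setOf_nearest_fixed (hd : UnramifiedLocalConjDatum σ ϖ)
    (γ : unitaryGroupOfForm σ ((StdForm.antidiagonal 3).over K))
    {u : {M : Submodule 𝒪[K] (Fin 3 → K) // IsVertex σ ϖ ((StdForm.antidiagonal 3).over K) M}}
    (hu : latticeGraphIso σ ϖ ((StdForm.antidiagonal 3).over K) γ u = u) (m : ℕ) :
    {x : {M : Submodule 𝒪[K] (Fin 3 → K) // IsVertex σ ϖ ((StdForm.antidiagonal 3).over K) M} |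
        IsSelfDualLattice σ ϖ ((StdForm.antidiagonal 3).over K) x.1 ∧
          (latticeGraph σ ϖ ((StdForm.antidiagonal 3).over K)).dist x (latticeGraphPerm σ ϖ ((StdForm.antidiagonal 3).over K) γ x) = 2 * m} =
      {x : {M : Submodule 𝒪[K] (Fin 3 → K) // IsVertex σ ϖ ((StdForm.antidiagonal 3).over K) M} |
        IsSelfDualLattice σ ϖ ((StdForm.antidiagonal 3).over K) x.1 ∧
          ∃ p, latticeGraphIso σ ϖ ((StdForm.antidiagonal 3).over K) γ p = p ∧
            (∀ q, latticeGraphIso σ ϖ ((StdForm.antidiagonal 3).over K) γ q = q →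
              (latticeGraph σ ϖ ((StdForm.antidiagonal 3).over K)).dist x p ≤ (latticeGraph σ ϖ ((StdForm.antidiagonal 3).over K)).dist x q) ∧
            (latticeGraph σ ϖ ((StdForm.antidiagonal 3).over K)).dist x p = m} := by
  have hT := isTree_latticeGraph_three_of_unramified hd
  ext x
  simp only [Set.mem_setOf_eq]
  refine and_congr_right fun _ => ⟨fun hx => ?_, fun hx => ?_⟩
  · -- a nearest fixed vertex exists (the fixed set contains `u`); W6-a gives `2·d(x, p) = d(x, γx) = 2m`
    have hne : ({p | latticeGraphIso σ ϖ ((StdForm.antidiagonal 3).over K) γ p = p} :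
        Set {M : Submodule 𝒪[K] (Fin 3 → K) // IsVertex σ ϖ ((StdForm.antidiagonal 3).over K) M}).Nonempty := ⟨u, hu⟩
    have hp : latticeGraphIso σ ϖ ((StdForm.antidiagonal 3).over K) γ
        (Function.argminOn (fun p => (latticeGraph σ ϖ ((StdForm.antidiagonal 3).over K)).dist x p)
          {p | latticeGraphIso σ ϖ ((StdForm.antidiagonal 3).over K) γ p = p} hne) = _ :=
      Function.argminOn_mem (fun p => (latticeGraph σ ϖ ((StdForm.antidiagonal 3).over K)).dist x p) _ hne
    have hmin : ∀ q, latticeGraphIso σ ϖ ((StdForm.antidiagonal 3).over K) γ q = q →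
        (latticeGraph σ ϖ ((StdForm.antidiagonal 3).over K)).dist x
            (Function.argminOn (fun p => (latticeGraph σ ϖ ((StdForm.antidiagonal 3).over K)).dist x p)
              {p | latticeGraphIso σ ϖ ((StdForm.antidiagonal 3).over K) γ p = p} hne) ≤
          (latticeGraph σ ϖ ((StdForm.antidiagonal 3).over K)).dist x q := fun q hq =>
      Function.argminOn_le (fun p => (latticeGraph σ ϖ ((StdForm.antidiagonal 3).over K)).dist x p)
        {p | latticeGraphIso σ ϖ ((StdForm.antidiagonal 3).over K) γ p = p} hq
    have h2 := TreeDisplacement.dist_self_apply_eq_two_mul_dist hT (latticeGraphIso σ ϖ ((StdForm.antidiagonal 3).over K) γ) hp hmin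
    refine ⟨_, hp, hmin, ?_⟩
    have h2' : 2 * (latticeGraph σ ϖ ((StdForm.antidiagonal 3).over K)).dist x
        (Function.argminOn (fun p => (latticeGraph σ ϖ ((StdForm.antidiagonal 3).over K)).dist x p)
          {p | latticeGraphIso σ ϖ ((StdForm.antidiagonal 3).over K) γ p = p} hne) = 2 * m := h2.symm.trans hx
    omega
  · obtain ⟨p, hp, hmin, hpm⟩ := hx
    have h2 := TreeDisplacement.dist_self_apply_eq_two_mul_dist hT (latticeGraphIso σ ϖ ((StdForm.antidiagonal 3).over K) γ) hp hmin
    rw [hpm] at h2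
    exact h2

/-- Bookkeeping: with a type function `c` (`c v = 0 ↔ v` self-dual), the displaced self-dual set is the displaced set of type `0`. [cite: BruhatTits1972, §10] -/
theorem setOf_selfDual_displaced_eq_setOf_displaced_type_zero (γ : unitaryGroupOfForm σ ((StdForm.antidiagonal 3).over K))
    (c : {M : Submodule 𝒪[K] (Fin 3 → K) // IsVertex σ ϖ ((StdForm.antidiagonal 3).over K) M} → Fin 2)
    (hc0 : ∀ v, c v = 0 ↔ IsSelfDualLattice σ ϖ ((StdForm.antidiagonal 3).over K) v.1) (k : ℕ) :
    {x : {M : Submodule 𝒪[K] (Fin 3 → K) // IsVertex σ ϖ ((StdForm.antidiagonal 3).over K) M} |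
        IsSelfDualLattice σ ϖ ((StdForm.antidiagonal 3).over K) x.1 ∧
          (latticeGraph σ ϖ ((StdForm.antidiagonal 3).over K)).dist x (latticeGraphPerm σ ϖ ((StdForm.antidiagonal 3).over K) γ x) = k} =
      {x | (latticeGraph σ ϖ ((StdForm.antidiagonal 3).over K)).dist x (latticeGraphIso σ ϖ ((StdForm.antidiagonal 3).over K) γ x) = k ∧ c x = 0} := by
  ext x
  simp only [Set.mem_setOf_eq, hc0]
  exact and_comm

/-! ## §3 THE ASSEMBLY: `O_γ(1_{K₀ tᵐ K₀}) = ν(K₀) · #{x hyperspecial : d(x, γ·x) = 2m}` at a compact centraliser -/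

variable (hd : UnramifiedLocalConjDatum σ ϖ)
  [LocallyCompactSpace (unitaryGroupOfForm σ ((StdForm.antidiagonal 3).over K))]
  [SecondCountableTopology (unitaryGroupOfForm σ ((StdForm.antidiagonal 3).over K))]
  [MeasurableSpace (unitaryGroupOfForm σ ((StdForm.antidiagonal 3).over K))] [BorelSpace (unitaryGroupOfForm σ ((StdForm.antidiagonal 3).over K))]
  (γ : unitaryGroupOfForm σ ((StdForm.antidiagonal 3).over K))
  [MeasurableSpace (unitaryGroupOfForm σ ((StdForm.antidiagonal 3).over K) ⧸
    Subgroup.centralizer ({γ} : Set (unitaryGroupOfForm σ ((StdForm.antidiagonal 3).over K))))]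
  [BorelSpace (unitaryGroupOfForm σ ((StdForm.antidiagonal 3).over K) ⧸
    Subgroup.centralizer ({γ} : Set (unitaryGroupOfForm σ ((StdForm.antidiagonal 3).over K))))]
  [hC : IsClosed ((Subgroup.centralizer ({γ} : Set (unitaryGroupOfForm σ ((StdForm.antidiagonal 3).over K))) :
    Subgroup (unitaryGroupOfForm σ ((StdForm.antidiagonal 3).over K))) : Set (unitaryGroupOfForm σ ((StdForm.antidiagonal 3).over K)))]
  (t : Measure (Subgroup.centralizer ({γ} : Set (unitaryGroupOfForm σ ((StdForm.antidiagonal 3).over K)))))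
  [t.IsMulLeftInvariant] [IsFiniteMeasureOnCompacts t] [t.IsOpenPosMeasure] [t.IsInvInvariant] [SFinite t]
  (ν : Measure (unitaryGroupOfForm σ ((StdForm.antidiagonal 3).over K))) [IsHaarMeasure ν] [ν.IsMulRightInvariant]
  [CompactSpace (Subgroup.centralizer ({γ} : Set (unitaryGroupOfForm σ ((StdForm.antidiagonal 3).over K))))]
  (ht : t Set.univ = 1)
include ht

/-- **CARD A1 — THE ELLIPTIC ORBITAL INTEGRAL OF `φ_m = 1_{K₀ tᵐ K₀}` IS A DISPLACEMENT COUNT**: for `γ ∈ U(σ, J₀)(K)` with COMPACT centraliser `C` (Haar measure `t` of mass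
one on `C`, `ν` a Haar measure on `U`) and every `m ∈ ℕ`, provided only finitely many hyperspecial vertices are displaced by `2m`,
`O_γ^{ν∕t}(1_{K₀ tᵐ K₀}) = ν(K₀) · #{x ∈ X : x self-dual ∧ d(x, γ·x) = 2m}`
— ★ (J1) `orbitalIntegral_indicator_quotientMeasure_eq_mul_ncard_shell` (§1 edition for the double coset `K₀ tᵐ K₀`, `K₀` open ★ `isOpen_unitaryInt`) composed with ★ (J2)
`ncard_quotient_shell_eq_ncard_selfDual_displaced` (cosets in the shell ↔ displaced hyperspecial vertices).  Rogawski's `Φ(γ, φ_m)` [§4.9 pp. 54–55] read on the tree.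
[cite: Rogawski1990, §4.9 pp. 54–55] [cite: Kottwitz1986BaseChangeUnits, §1 pp. 240–242] [cite: BruhatTits1972, §10] -/
theorem orbitalIntegral_doubleCosetShell_eq_mul_ncard_displaced (m : ℕ)
    (hfin : {x : {M : Submodule 𝒪[K] (Fin 3 → K) // IsVertex σ ϖ ((StdForm.antidiagonal 3).over K) M} |
        IsSelfDualLattice σ ϖ ((StdForm.antidiagonal 3).over K) x.1 ∧
          (latticeGraph σ ϖ ((StdForm.antidiagonal 3).over K)).dist x (latticeGraphPerm σ ϖ ((StdForm.antidiagonal 3).over K) γ x) = 2 * m}.Finite) :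
    orbitalIntegral γ
        ((DoubleCoset.doubleCoset (hd.torusGen ^ m) (unitaryInt σ ((StdForm.antidiagonal 3).over K) : Set _)
            (unitaryInt σ ((StdForm.antidiagonal 3).over K))).indicator (1 : unitaryGroupOfForm σ ((StdForm.antidiagonal 3).over K) → ℝ))
        (quotientMeasure (Subgroup.centralizer ({γ} : Set (unitaryGroupOfForm σ ((StdForm.antidiagonal 3).over K)))) t hC ν) =
      (ν (unitaryInt σ ((StdForm.antidiagonal 3).over K))).toReal *
        ({x : {M : Submodule 𝒪[K] (Fin 3 → K) // IsVertex σ ϖ ((StdForm.antidiagonal 3).over K) M} |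
            IsSelfDualLattice σ ϖ ((StdForm.antidiagonal 3).over K) x.1 ∧
              (latticeGraph σ ϖ ((StdForm.antidiagonal 3).over K)).dist x
                (latticeGraphPerm σ ϖ ((StdForm.antidiagonal 3).over K) γ x) = 2 * m}.ncard : ℝ) := by
  rw [orbitalIntegral_indicator_doubleCoset_eq_mul_ncard_orbitShell (unitaryInt σ ((StdForm.antidiagonal 3).over K)) (hd.torusGen ^ m) γ t ν
      (isOpen_unitaryInt σ _) ht (finite_quotient_shell_of_finite_displaced hd γ m hfin),
    ncard_quotient_shell_eq_ncard_selfDual_displaced hd γ m]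

/-- **CARD A1, ELLIPTIC EDITION (finiteness discharged)**: if `γ` (compact centraliser of `t`-mass one) fixes a vertex `u` of the locally finite tree (`hloc`) and has finite fixed
set, then for EVERY `m`, `O_γ^{ν∕t}(1_{K₀ tᵐ K₀}) = ν(K₀) · #{x self-dual : d(x, γ·x) = 2m}` (§2 `finite_selfDual_displaced_of_finite_fixedPoints`).
[cite: Rogawski1990, §4.9 pp. 54–55] [cite: Serre1980Trees, I.6.4 Prop. 24] [cite: Kottwitz1986BaseChangeUnits, §1 pp. 240–242] -/
theorem orbitalIntegral_doubleCosetShell_eq_mul_ncard_displaced_of_finite_fixedPoints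
    (hloc : ∀ v, ((latticeGraph σ ϖ ((StdForm.antidiagonal 3).over K)).neighborSet v).Finite)
    {u : {M : Submodule 𝒪[K] (Fin 3 → K) // IsVertex σ ϖ ((StdForm.antidiagonal 3).over K) M}}
    (hu : latticeGraphIso σ ϖ ((StdForm.antidiagonal 3).over K) γ u = u)
    (hfix : {v | latticeGraphIso σ ϖ ((StdForm.antidiagonal 3).over K) γ v = v}.Finite) (m : ℕ) :
    orbitalIntegral γ
        ((DoubleCoset.doubleCoset (hd.torusGen ^ m) (unitaryInt σ ((StdForm.antidiagonal 3).over K) : Set _)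
            (unitaryInt σ ((StdForm.antidiagonal 3).over K))).indicator (1 : unitaryGroupOfForm σ ((StdForm.antidiagonal 3).over K) → ℝ))
        (quotientMeasure (Subgroup.centralizer ({γ} : Set (unitaryGroupOfForm σ ((StdForm.antidiagonal 3).over K)))) t hC ν) =
      (ν (unitaryInt σ ((StdForm.antidiagonal 3).over K))).toReal *
        ({x : {M : Submodule 𝒪[K] (Fin 3 → K) // IsVertex σ ϖ ((StdForm.antidiagonal 3).over K) M} |
            IsSelfDualLattice σ ϖ ((StdForm.antidiagonal 3).over K) x.1 ∧
              (latticeGraph σ ϖ ((StdForm.antidiagonal 3).over K)).dist x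
                (latticeGraphPerm σ ϖ ((StdForm.antidiagonal 3).over K) γ x) = 2 * m}.ncard : ℝ) :=
  orbitalIntegral_doubleCosetShell_eq_mul_ncard_displaced hd γ t ν ht m (finite_selfDual_displaced_of_finite_fixedPoints hd γ hloc hu hfix m)

/-- **CARD A1, «DISTANCE TO THE FIXED SUBTREE» EDITION**: for `γ` with compact centraliser (mass-one `t`) fixing a vertex `u`, and finitely many hyperspecial vertices displaced
by `2m`, `O_γ^{ν∕t}(1_{K₀ tᵐ K₀}) = ν(K₀) · #{x self-dual : d(x, Fix γ) = m}`, where «`d(x, Fix γ) = m`» is spelled «some NEAREST `γ`-fixed vertex `p` of `x` has `d(x, p) = m`»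
(the binders of ★ W6-a `dist_map_eq_two_mul_of_nearest_fixed`; Serre I.6.4: `d(x, γx) = 2·d(x, Fix γ)`). [cite: Rogawski1990, §4.9 pp. 54–55] [cite: Serre1980Trees, I.6.4 Prop. 24–25] -/
theorem orbitalIntegral_doubleCosetShell_eq_mul_ncard_nearest_fixed
    {u : {M : Submodule 𝒪[K] (Fin 3 → K) // IsVertex σ ϖ ((StdForm.antidiagonal 3).over K) M}}
    (hu : latticeGraphIso σ ϖ ((StdForm.antidiagonal 3).over K) γ u = u) (m : ℕ)
    (hfin : {x : {M : Submodule 𝒪[K] (Fin 3 → K) // IsVertex σ ϖ ((StdForm.antidiagonal 3).over K) M} |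
        IsSelfDualLattice σ ϖ ((StdForm.antidiagonal 3).over K) x.1 ∧
          (latticeGraph σ ϖ ((StdForm.antidiagonal 3).over K)).dist x (latticeGraphPerm σ ϖ ((StdForm.antidiagonal 3).over K) γ x) = 2 * m}.Finite) :
    orbitalIntegral γ
        ((DoubleCoset.doubleCoset (hd.torusGen ^ m) (unitaryInt σ ((StdForm.antidiagonal 3).over K) : Set _)
            (unitaryInt σ ((StdForm.antidiagonal 3).over K))).indicator (1 : unitaryGroupOfForm σ ((StdForm.antidiagonal 3).over K) → ℝ))
        (quotientMeasure (Subgroup.centralizer ({γ} : Set (unitaryGroupOfForm σ ((StdForm.antidiagonal 3).over K)))) t hC ν) =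
      (ν (unitaryInt σ ((StdForm.antidiagonal 3).over K))).toReal *
        ({x : {M : Submodule 𝒪[K] (Fin 3 → K) // IsVertex σ ϖ ((StdForm.antidiagonal 3).over K) M} |
            IsSelfDualLattice σ ϖ ((StdForm.antidiagonal 3).over K) x.1 ∧
              ∃ p, latticeGraphIso σ ϖ ((StdForm.antidiagonal 3).over K) γ p = p ∧
                (∀ q, latticeGraphIso σ ϖ ((StdForm.antidiagonal 3).over K) γ q = q →
                  (latticeGraph σ ϖ ((StdForm.antidiagonal 3).over K)).dist x p ≤
                    (latticeGraph σ ϖ ((StdForm.antidiagonal 3).over K)).dist x q) ∧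
                (latticeGraph σ ϖ ((StdForm.antidiagonal 3).over K)).dist x p = m}.ncard : ℝ) := by
  rw [orbitalIntegral_doubleCosetShell_eq_mul_ncard_displaced hd γ t ν ht m hfin, setOf_selfDual_displaced_eq_setOf_nearest_fixed hd γ hu m]

/-! ## §4 CLOSED FORM modulo the first displacement shell (★ W8-f): `O_γ(φ_{2n+1})`, `O_γ(φ_{2n+2})` -/

/-- **CLOSED FORM, ODD INDEX**: `γ` with compact centraliser (mass-one `t`) fixing a vertex `u`, finite fixed set, locally finite tree (`hloc`), `c` a type function (`c v = 0 ↔ v`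
self-dual) and every MOVED vertex `v` of valency `q (c v) + 1` (for `U(3)_w` at an inert place `q = (q_v³, q_v)`, ★ `ncard_neighborSet_eq_typeFun`).  Then for every `n`,
`O_γ^{ν∕t}(1_{K₀ t^{2n+1} K₀}) = ν(K₀) · (q 1 · q 0)ⁿ · #{x : d(x, γx) = 2 ∧ c x = 0}` — §3 with ★ W8-f `ncard_displaced_inter_type_eq_of_odd` (the hyperspecial shells at odd
distance `2n+1` from `Fix γ` descend to the hyperspecial FIRST shell). [cite: Rogawski1990, §4.9 pp. 54–55] [cite: Serre1980Trees, I.2.3, I.6.4 Prop. 24] -/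
theorem orbitalIntegral_doubleCosetShell_odd_eq
    (hloc : ∀ v, ((latticeGraph σ ϖ ((StdForm.antidiagonal 3).over K)).neighborSet v).Finite)
    {u : {M : Submodule 𝒪[K] (Fin 3 → K) // IsVertex σ ϖ ((StdForm.antidiagonal 3).over K) M}}
    (hu : latticeGraphIso σ ϖ ((StdForm.antidiagonal 3).over K) γ u = u)
    (hfix : {v | latticeGraphIso σ ϖ ((StdForm.antidiagonal 3).over K) γ v = v}.Finite)
    (c : {M : Submodule 𝒪[K] (Fin 3 → K) // IsVertex σ ϖ ((StdForm.antidiagonal 3).over K) M} → Fin 2)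
    (hc0 : ∀ v, c v = 0 ↔ IsSelfDualLattice σ ϖ ((StdForm.antidiagonal 3).over K) v.1) (q : Fin 2 → ℕ)
    (hdeg : ∀ v, latticeGraphIso σ ϖ ((StdForm.antidiagonal 3).over K) γ v ≠ v →
      ((latticeGraph σ ϖ ((StdForm.antidiagonal 3).over K)).neighborSet v).ncard = q (c v) + 1) (n : ℕ) :
    orbitalIntegral γ
        ((DoubleCoset.doubleCoset (hd.torusGen ^ (2 * n + 1)) (unitaryInt σ ((StdForm.antidiagonal 3).over K) : Set _)
            (unitaryInt σ ((StdForm.antidiagonal 3).over K))).indicator (1 : unitaryGroupOfForm σ ((StdForm.antidiagonal 3).over K) → ℝ))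
        (quotientMeasure (Subgroup.centralizer ({γ} : Set (unitaryGroupOfForm σ ((StdForm.antidiagonal 3).over K)))) t hC ν) =
      (ν (unitaryInt σ ((StdForm.antidiagonal 3).over K))).toReal *
        (((q 1 * q 0) ^ n *
            {x | (latticeGraph σ ϖ ((StdForm.antidiagonal 3).over K)).dist x (latticeGraphIso σ ϖ ((StdForm.antidiagonal 3).over K) γ x) = 2 ∧
              c x = 0}.ncard : ℕ) : ℝ) := by
  classical
  have hT := isTree_latticeGraph_three_of_unramified hd
  haveI : (latticeGraph σ ϖ ((StdForm.antidiagonal 3).over K)).LocallyFinite := fun v => (hloc v).fintype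
  have hdeg' : ∀ v, latticeGraphIso σ ϖ ((StdForm.antidiagonal 3).over K) γ v ≠ v →
      (latticeGraph σ ϖ ((StdForm.antidiagonal 3).over K)).degree v = q (c v) + 1 := fun v hv => by
    rw [TreeDisplacement.degree_eq_ncard_neighborSet]; exact hdeg v hv
  rw [orbitalIntegral_doubleCosetShell_eq_mul_ncard_displaced_of_finite_fixedPoints hd γ t ν ht hloc hu hfix (2 * n + 1),
    setOf_selfDual_displaced_eq_setOf_displaced_type_zero γ c hc0,
    ncard_displaced_inter_type_eq_of_odd hT (latticeGraphIso σ ϖ ((StdForm.antidiagonal 3).over K) γ) hu hfix c (typeFun_ne_of_adj hd hc0) q hdeg'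
      Fin.zero_ne_one n]

/-- **CLOSED FORM, EVEN POSITIVE INDEX**: same hypotheses; for every `n`, `O_γ^{ν∕t}(1_{K₀ t^{2n+2} K₀}) = ν(K₀) · q 1 · (q 0 · q 1)ⁿ · #{x : d(x, γx) = 2 ∧ c x = 1}` — §3 with
★ W8-f `ncard_displaced_inter_type_eq_of_even` (the hyperspecial shells at even distance `2n+2` from `Fix γ` descend to the TYPE-TWO first shell).
[cite: Rogawski1990, §4.9 pp. 54–55] [cite: Serre1980Trees, I.2.3, I.6.4 Prop. 24] -/
theorem orbitalIntegral_doubleCosetShell_even_eq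
    (hloc : ∀ v, ((latticeGraph σ ϖ ((StdForm.antidiagonal 3).over K)).neighborSet v).Finite)
    {u : {M : Submodule 𝒪[K] (Fin 3 → K) // IsVertex σ ϖ ((StdForm.antidiagonal 3).over K) M}}
    (hu : latticeGraphIso σ ϖ ((StdForm.antidiagonal 3).over K) γ u = u)
    (hfix : {v | latticeGraphIso σ ϖ ((StdForm.antidiagonal 3).over K) γ v = v}.Finite)
    (c : {M : Submodule 𝒪[K] (Fin 3 → K) // IsVertex σ ϖ ((StdForm.antidiagonal 3).over K) M} → Fin 2)
    (hc0 : ∀ v, c v = 0 ↔ IsSelfDualLattice σ ϖ ((StdForm.antidiagonal 3).over K) v.1) (q : Fin 2 → ℕ)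
    (hdeg : ∀ v, latticeGraphIso σ ϖ ((StdForm.antidiagonal 3).over K) γ v ≠ v →
      ((latticeGraph σ ϖ ((StdForm.antidiagonal 3).over K)).neighborSet v).ncard = q (c v) + 1) (n : ℕ) :
    orbitalIntegral γ
        ((DoubleCoset.doubleCoset (hd.torusGen ^ (2 * n + 2)) (unitaryInt σ ((StdForm.antidiagonal 3).over K) : Set _)
            (unitaryInt σ ((StdForm.antidiagonal 3).over K))).indicator (1 : unitaryGroupOfForm σ ((StdForm.antidiagonal 3).over K) → ℝ))
        (quotientMeasure (Subgroup.centralizer ({γ} : Set (unitaryGroupOfForm σ ((StdForm.antidiagonal 3).over K)))) t hC ν) =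
      (ν (unitaryInt σ ((StdForm.antidiagonal 3).over K))).toReal *
        ((q 1 * (q 0 * q 1) ^ n *
            {x | (latticeGraph σ ϖ ((StdForm.antidiagonal 3).over K)).dist x (latticeGraphIso σ ϖ ((StdForm.antidiagonal 3).over K) γ x) = 2 ∧
              c x = 1}.ncard : ℕ) : ℝ) := by
  classical
  have hT := isTree_latticeGraph_three_of_unramified hd
  haveI : (latticeGraph σ ϖ ((StdForm.antidiagonal 3).over K)).LocallyFinite := fun v => (hloc v).fintype
  have hdeg' : ∀ v, latticeGraphIso σ ϖ ((StdForm.antidiagonal 3).over K) γ v ≠ v →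
      (latticeGraph σ ϖ ((StdForm.antidiagonal 3).over K)).degree v = q (c v) + 1 := fun v hv => by
    rw [TreeDisplacement.degree_eq_ncard_neighborSet]; exact hdeg v hv
  rw [orbitalIntegral_doubleCosetShell_eq_mul_ncard_displaced_of_finite_fixedPoints hd γ t ν ht hloc hu hfix (2 * n + 2),
    setOf_selfDual_displaced_eq_setOf_displaced_type_zero γ c hc0,
    ncard_displaced_inter_type_eq_of_even hT (latticeGraphIso σ ϖ ((StdForm.antidiagonal 3).over K) γ) hu hfix c (typeFun_ne_of_adj hd hc0) q hdeg'
      Fin.zero_ne_one n]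

end Unitary

end Summit.HodgeConjecture.HodgeConjecture.R90.S6

end
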